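import Summits.ResolutionOfSingularities.ResolutionOfSingularities.Theorems.ValuativeLuAlphaPTorsorCurveMonomializationDivisors
import Summits.ResolutionOfSingularities.ResolutionOfSingularities.Theorems.ValuativeLuAlphaPTorsorCurveMonomializationStep
import Literature.AlgebraicGeometry.Resolution.QuadraticTransformsProofs

/-!
# Normal crossings of the new divisors along the quadratic sequence, and exhaustion of the old

Helper file for the stub `stub_curveMonomialization` of the line `pfaff-line-log-final-forms`
(crux `Valuative.LuAlphaPTorsor`, item `stmt-ResolutionOfSingularities-0641`): embedded
resolution of a plane curve germ `b = 0` along a valuation by quadratic transforms (Zariski;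
Abhyankar 1956).

Along the quadratic sequence `R₀ → R₁ → ⋯` of a two-dimensional regular local ring along a
valuation ring `O` (all members two-dimensional), the prime divisors of `b` on `Spec Rᵢ` are the
valuation rings `W ⊇ Rᵢ` with `w(b) > 0` not dominating `Rᵢ` (`…CurveMonomializationDivisors`).
PROVED here:

* `good_succ`, `good_iterate` — **the invariant**: if, outside a fixed set `F` of divisors, every
  divisor of `b` on `Spec Rᵢ` passes through `u = 0` or `v = 0` for a regular system of
  parameters `(u, v)` of `Rᵢ`, then the same holds on `Spec R_{i+1}` for a suitable regular system
  of parameters: either no divisor outside `F` survives (then the new ones are exceptional, cut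
  out by the chart element, `exists_maximalIdeal_eq_span_pair_of_step`), or one with `w(u) > 0`
  survives and `𝔪_{i+1} = (v, u/v)` (`key_step`);
* `propagate` — a divisor through the centre regular at stage `i` (`(q) = 𝔪_W ∩ Rᵢ`,
  `q ∉ 𝔪ᵢ²`) which survives is regular at stage `i + 1` (`q/v ∉ 𝔪_{i+1}²`);
* `exists_forall_not_le` — **exhaustion**: finitely many divisors none of which contains `O`
  all disappear after finitely many steps (Abhyankar's union lemma `O = ⋃ Rᵢ`,
  `AbhyankarQuadraticUnion_holds`).

All [folklore] (Zariski; Abhyankar 1956, §2; Huneke–Swanson 2006, Ch. 14).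
-/

set_option linter.dupNamespace false

namespace Summit.ResolutionOfSingularities.ResolutionOfSingularities.Theorems.PfaffLine.CurveMono

open IsLocalRing Literature.AlgebraicGeometry.Resolution

variable {K : Type} [Field K]

/-! ## Regular divisors stay regular -/

/-- **A surviving regular divisor stays regular.** If `W ⊇ R₁ ⊇ R` is a valuation ring not
dominating the two-dimensional regular local ring `R`, with `w(q) > 0` for some `q ∈ R ∖ 𝔪_R²`,
then `w(q₁) > 0` for some `q₁ ∈ R₁ ∖ 𝔪_{R₁}²` (namely `q₁ = q/v` where `𝔪_R = (q, v)`,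
`𝔪_{R₁} = (v, q/v)`). [folklore] -/
theorem propagate {O W : ValuationSubring K} {R R₁ : Subring K} [IsRegularLocalRing R]
    [IsRegularLocalRing R₁] (hdim : ringKrullDim R = 2) (hdim₁ : ringKrullDim R₁ = 2)
    (hO : SubringDominates R O.toSubring) (h : IsQuadraticTransformAlong O R R₁)
    (hR₁W : R₁ ≤ W.toSubring) (hnd : ¬ SubringDominates R W.toSubring) {q : R}
    (hq : W.valuation (q : K) < 1) (hq2 : q ∉ maximalIdeal R ^ 2) :
    ∃ q₁ : R₁, W.valuation (q₁ : K) < 1 ∧ q₁ ∉ maximalIdeal R₁ ^ 2 := by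
  have hRW : R ≤ W.toSubring := h.le.trans hR₁W
  have hqm : q ∈ maximalIdeal R := by
    rw [mem_maximalIdeal_iff_inv_not_mem]
    exact ((valuation_lt_one_iff_or W _).mp hq).imp_right fun h' hR => h' (hRW hR)
  obtain ⟨v, huv, -, -⟩ := exists_maximalIdeal_eq_span_pair_of_not_mem_sq hdim hqm hq2
  have hv : ¬ W.valuation (v : K) < 1 := not_valuation_lt_one_of_span_pair hRW hnd huv hq
  obtain ⟨hv₁, ht₁, hm₁⟩ := key_step hdim hO h huv hR₁W hq hv
  refine ⟨⟨_, ht₁⟩, ?_, not_mem_sq_of_span_pair hdim₁ (by rw [hm₁, Set.pair_comm])⟩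
  exact valuation_div_lt_one hq (valuation_eq_one_of_not_lt (hRW v.2) hv)

/-! ## The invariant: the divisors outside `F` through the centre are cut out by parameters -/

/-- **One step of the invariant.** Let `R → R₁` be the quadratic transform along `O` of the
two-dimensional regular local ring `R` of `K`, `F` a set of valuation rings, `b ∈ K`, and
`𝔪_R = (u, v)` such that every divisor `W` of `b` on `Spec R` (a valuation ring `W ⊇ R` with
`w(b) > 0` not dominating `R`) outside `F` has `w(u) > 0` or `w(v) > 0`. Then `𝔪_{R₁} = (u₁, v₁)`
with the same property on `Spec R₁`: if some divisor `W₀ ∉ F` of `b` on `Spec R` survives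
(`R₁ ⊆ W₀`), say with `w₀(u) > 0`, take `(u₁, v₁) = (v, u/v)` (`key_step`); otherwise take the
chart element and a complementary parameter (the new divisors dominate `R`). [folklore] -/
theorem good_succ {O : ValuationSubring K} {R R₁ : Subring K} [IsRegularLocalRing R]
    [IsRegularLocalRing R₁] (hdim : ringKrullDim R = 2) (hO : SubringDominates R O.toSubring)
    (h : IsQuadraticTransformAlong O R R₁) (F : Set (ValuationSubring K)) (b : K) {u v : R}
    (huv : maximalIdeal R = Ideal.span {u, v})
    (hgood : ∀ W : ValuationSubring K, R ≤ W.toSubring → W.valuation b < 1 →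
      ¬ SubringDominates R W.toSubring →
        W ∈ F ∨ W.valuation (u : K) < 1 ∨ W.valuation (v : K) < 1) :
    ∃ u₁ v₁ : R₁, maximalIdeal R₁ = Ideal.span {u₁, v₁} ∧
      ∀ W : ValuationSubring K, R₁ ≤ W.toSubring → W.valuation b < 1 →
        ¬ SubringDominates R₁ W.toSubring →
          W ∈ F ∨ W.valuation (u₁ : K) < 1 ∨ W.valuation (v₁ : K) < 1 := by
  have hRR₁ : R ≤ R₁ := h.le
  -- the case of a surviving divisor with `w₀(u) > 0`, for any regular system `(u, v)`
  have key : ∀ {u v : R}, maximalIdeal R = Ideal.span {u, v} →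
      (∀ W : ValuationSubring K, R ≤ W.toSubring → W.valuation b < 1 →
        ¬ SubringDominates R W.toSubring →
          W ∈ F ∨ W.valuation (u : K) < 1 ∨ W.valuation (v : K) < 1) →
      ∀ W₀ : ValuationSubring K, R₁ ≤ W₀.toSubring → ¬ SubringDominates R W₀.toSubring →
        W₀.valuation (u : K) < 1 →
      ∃ u₁ v₁ : R₁, maximalIdeal R₁ = Ideal.span {u₁, v₁} ∧
        ∀ W : ValuationSubring K, R₁ ≤ W.toSubring → W.valuation b < 1 →
          ¬ SubringDominates R₁ W.toSubring →
            W ∈ F ∨ W.valuation (u₁ : K) < 1 ∨ W.valuation (v₁ : K) < 1 := by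
    intro u v huv hgood W₀ hW₀ hnd₀ hu
    have hRW₀ : R ≤ W₀.toSubring := hRR₁.trans hW₀
    have hv : ¬ W₀.valuation (v : K) < 1 := not_valuation_lt_one_of_span_pair hRW₀ hnd₀ huv hu
    obtain ⟨hv₁, ht₁, hm₁⟩ := key_step hdim hO h huv hW₀ hu hv
    refine ⟨⟨_, hv₁⟩, ⟨_, ht₁⟩, hm₁, fun W hW hbW _ => ?_⟩
    have hRW : R ≤ W.toSubring := hRR₁.trans hW
    by_cases hd : SubringDominates R W.toSubring
    · exact Or.inr (Or.inl (valuation_lt_one_of_dominates hd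
        (huv ▸ Ideal.subset_span (by simp))))
    · rcases hgood W hRW hbW hd with hF | hu' | hv'
      · exact Or.inl hF
      · by_cases hv' : W.valuation (v : K) < 1
        · exact Or.inr (Or.inl hv')
        · exact Or.inr (Or.inr (valuation_div_lt_one hu'
            (valuation_eq_one_of_not_lt (hRW v.2) hv')))
      · exact Or.inr (Or.inl hv')
  by_cases hsurv : ∃ W : ValuationSubring K, R₁ ≤ W.toSubring ∧ W.valuation b < 1 ∧
      ¬ SubringDominates R W.toSubring ∧ W ∉ F
  · obtain ⟨W₀, hW₀, hbW₀, hnd₀, hF₀⟩ := hsurv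
    rcases hgood W₀ (hRR₁.trans hW₀) hbW₀ hnd₀ with hF | hu | hv
    · exact absurd hF hF₀
    · exact key huv hgood W₀ hW₀ hnd₀ hu
    · have huv' : maximalIdeal R = Ideal.span {v, u} := by rw [huv, Set.pair_comm]
      exact key huv' (fun W h1 h2 h3 => (hgood W h1 h2 h3).imp_right Or.symm) W₀ hW₀ hnd₀ hv
  · push Not at hsurv
    obtain ⟨x, f, hxR, hxinv, hm₁⟩ := exists_maximalIdeal_eq_span_pair_of_step hdim hO h
    refine ⟨x, f, hm₁, fun W hW hbW _ => ?_⟩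
    by_cases hd : SubringDominates R W.toSubring
    · refine Or.inr (Or.inl ?_)
      have hxm : (⟨(x : K), hxR⟩ : R) ∈ maximalIdeal R :=
        (mem_maximalIdeal_iff_inv_not_mem _).mpr (Or.inr hxinv)
      exact valuation_lt_one_of_dominates hd hxm
    · exact Or.inl (hsurv W hW hbW hd)

/-- **The invariant along the sequence**: from stage `i` on, at every stage `i + n` there is a
regular system of parameters `(u', v')` of `R_{i+n}` such that every divisor of `b` outside `F`
passes through `u' = 0` or `v' = 0`. [folklore] -/
theorem good_iterate {O : ValuationSubring K} {R : ℕ → Subring K}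
    (hreg : ∀ i, IsRegularLocalRing (R i)) (hdim : ∀ i, ringKrullDim (R i) = 2)
    (h0 : SubringDominates (R 0) O.toSubring)
    (hstep : ∀ i, IsQuadraticTransformAlong O (R i) (R (i + 1)))
    (F : Set (ValuationSubring K)) (b : K) (i : ℕ) {u v : R i}
    (huv : maximalIdeal (R i) = Ideal.span {u, v})
    (hgood : ∀ W : ValuationSubring K, R i ≤ W.toSubring → W.valuation b < 1 →
      ¬ SubringDominates (R i) W.toSubring →
        W ∈ F ∨ W.valuation (u : K) < 1 ∨ W.valuation (v : K) < 1) (n : ℕ) :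
    ∃ u' v' : R (i + n), maximalIdeal (R (i + n)) = Ideal.span {u', v'} ∧
      ∀ W : ValuationSubring K, R (i + n) ≤ W.toSubring → W.valuation b < 1 →
        ¬ SubringDominates (R (i + n)) W.toSubring →
          W ∈ F ∨ W.valuation (u' : K) < 1 ∨ W.valuation (v' : K) < 1 := by
  haveI := hreg
  induction n with
  | zero => exact ⟨u, v, huv, hgood⟩
  | succ n ih =>
    obtain ⟨u', v', huv', hgood'⟩ := ih
    exact good_succ (hdim (i + n)) (sequence_dominates h0 hstep (i + n)).1 (hstep (i + n)) F b
      huv' hgood'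

/-! ## Exhaustion of the divisors not containing `O` -/

/-- **Exhaustion (Abhyankar's union lemma).** Along the quadratic sequence of a two-dimensional
regular local ring `R₀` of `K` along `O`, finitely many valuation rings none of which contains
`O` each fail to contain `R_j` for all large `j`: pick `z ∈ O ∖ W`; by `O = ⋃ Rᵢ`
(`AbhyankarQuadraticUnion_holds`) `z ∈ R_j` for some `j`.
[cite: Abhyankar1956Valuations, Lemma 12] -/
theorem exists_forall_not_le {O : ValuationSubring K} {R : ℕ → Subring K}
    (hreg : IsRegularLocalRing (R 0)) (hdim : ringKrullDim (R 0) = 2) (hof : IsLocalRingOf (R 0))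
    (h0 : SubringDominates (R 0) O.toSubring)
    (hstep : ∀ i, IsQuadraticTransformAlong O (R i) (R (i + 1)))
    {F : Set (ValuationSubring K)} (hF : F.Finite) (hFO : ∀ W ∈ F, ¬ O ≤ W) :
    ∃ j, ∀ W ∈ F, ∀ j', j ≤ j' → ¬ R j' ≤ W.toSubring := by
  classical
  have hmono : Monotone R := sequence_monotone hstep
  have key : ∀ W : ValuationSubring K, ∃ j, W ∈ F → ∀ j', j ≤ j' → ¬ R j' ≤ W.toSubring := by
    intro W
    by_cases hW : W ∈ F
    · obtain ⟨z, hzO, hzW⟩ : ∃ z ∈ O, z ∉ W := by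
        by_contra hcon
        push Not at hcon
        exact hFO W hW fun z hz => hcon z hz
      obtain ⟨j, hj⟩ := (AbhyankarQuadraticUnion_holds K O R hreg hdim hof h0 hstep z).mp hzO
      exact ⟨j, fun _ j' hjj' hle => hzW (hle (hmono hjj' hj))⟩
    · exact ⟨0, fun h => absurd h hW⟩
  choose jW hjW using key
  exact ⟨hF.toFinset.sup jW, fun W hW j' hj' =>
    hjW W hW j' ((Finset.le_sup (hF.mem_toFinset.mpr hW)).trans hj')⟩

/-- Members of the sequence dominate earlier members. [folklore] -/
theorem subringDominates_add {O : ValuationSubring K} {R : ℕ → Subring K}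
    (h0 : SubringDominates (R 0) O.toSubring)
    (hstep : ∀ i, IsQuadraticTransformAlong O (R i) (R (i + 1))) (a n : ℕ) :
    SubringDominates (R a) (R (a + n)) := by
  induction n with
  | zero => exact SubringDominates.refl _
  | succ n ih =>
    exact ih.trans (((hstep (a + n)).isQuadraticTransform
      (sequence_dominates h0 hstep (a + n)).1).dominates)

end Summit.ResolutionOfSingularities.ResolutionOfSingularities.Theorems.PfaffLine.CurveMono

namespace Summit.ResolutionOfSingularities.ResolutionOfSingularities.Theorems.PfaffLine

/-- **Registered sub-goal `curveMono_good_iterate`** (universe `0`, for `--supports`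
registration): the normal-crossings invariant of the divisors of `b` outside a fixed set `F`
propagates along the quadratic sequence. [folklore] -/
theorem curveMono_good_iterate : ∀ {K : Type} [Field K] {O : ValuationSubring K} {R : ℕ → Subring K} (hreg : ∀ i, IsRegularLocalRing (R i)), (∀ i, ringKrullDim (R i) = 2) → Literature.AlgebraicGeometry.Resolution.SubringDominates (R 0) O.toSubring → (∀ i, Literature.AlgebraicGeometry.Resolution.IsQuadraticTransformAlong O (R i) (R (i + 1))) → ∀ (F : Set (ValuationSubring K)) (b : K) (i : ℕ) {u v : R i}, IsLocalRing.maximalIdeal (R i) = Ideal.span {u, v} → (∀ W : ValuationSubring K, R i ≤ W.toSubring → W.valuation b < 1 → ¬ Literature.AlgebraicGeometry.Resolution.SubringDominates (R i) W.toSubring → W ∈ F ∨ W.valuation (u : K) < 1 ∨ W.valuation (v : K) < 1) → ∀ n : ℕ, ∃ u' v' : R (i + n), IsLocalRing.maximalIdeal (R (i + n)) = Ideal.span {u', v'} ∧ ∀ W : ValuationSubring K, R (i + n) ≤ W.toSubring → W.valuation b < 1 → ¬ Literature.AlgebraicGeometry.Resolution.SubringDominates (R (i + n)) W.toSubring → W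 ∈ F ∨ W.valuation (u' : K) < 1 ∨ W.valuation (v' : K) < 1 := by
  intro K _ O R hreg hdim h0 hstep F b i u v huv hgood n
  exact CurveMono.good_iterate hreg hdim h0 hstep F b i huv hgood n

end Summit.ResolutionOfSingularities.ResolutionOfSingularities.Theorems.PfaffLine
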